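import Literature.NumberTheory.DiophantineGeometry.CatalanReduction
import Literature.NumberTheory.DiophantineGeometry.CatalanEuler
import HarnessLib

/-!
# Catalan / Mihăilescu (abc.S19): the assembly with Euler's case discharged

`Literature.NumberTheory.DiophantineGeometry.Catalan.mihailescu_of_euler_of_mihailescu_theorems`
(`CatalanReduction`) proves `Literature.NumberTheory.DiophantineGeometry.mihailescu` from four
hypotheses: Euler's case `x ² = y ³ + 1 ⇒ (x, y) = (3, 2)` and Mihăilescu's Theorems I, II, III
[Schoof2009, Chapter 1]. Euler's case is now a theorem of the tree
(`Literature.NumberTheory.DiophantineGeometry.Catalan.euler`, `CatalanEuler`, [Schoof2009,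
Proposition 4.2], via the units of `ℤ[∛2]`), so this file plugs it in:

* `Catalan.sq_eq_cube_add_one` — Euler's case in the natural-number shape consumed by
  `Catalan.mihailescu_of_cubic_of_odd_primes`;
* `Catalan.mihailescu_of_odd_primes` — `mihailescu` follows from the odd prime case alone
  (Lebesgue, Ko Chao and Euler being proved);
* `Catalan.mihailescu_of_mihailescu_theorems` — `mihailescu` follows from Mihăilescu's Theorems
  I, II, III alone, stated exactly as on [Schoof2009, p. 4] for odd primes `p, q` and non-zero
  integers `x, y` with `x ^ p - y ^ q = 1` (Theorem I via `IsWieferich`, abc.S15).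

So what separates the tree from `mihailescu_holds` is exactly Mihăilescu's Theorems I
(double Wieferich, J. Number Theory **99** (2003); [Schoof2009, Ch. 10]), II (Crelle **572**
(2004) [Mihailescu2004]; [Schoof2009, Ch. 12–14, 16]) and III (J. Number Theory **118** (2006);
[Schoof2009, Ch. 11]). No named fact is introduced; nothing restates `mihailescu`.
-/

namespace Literature.NumberTheory.DiophantineGeometry

namespace Catalan

/-- **Euler's case in natural numbers** [Schoof2009, Proposition 4.2]: `x ² = y ³ + 1` with
`y > 0` forces `(x, y) = (3, 2)` — from `Catalan.euler` (integers, both signs of `x`).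
[cite: Schoof2009, Proposition 4.2] -/
theorem sq_eq_cube_add_one {x y : ℕ} (hy : 0 < y) (h : x ^ 2 = y ^ 3 + 1) : x = 3 ∧ y = 2 := by
  have hx : x ≠ 0 := by
    rintro rfl
    rw [zero_pow two_ne_zero] at h
    omega
  have hZ : (x : ℤ) ^ 2 - (y : ℤ) ^ 3 = 1 := by
    have h' := congrArg (fun n : ℕ => (n : ℤ)) h
    push_cast at h'
    linarith
  obtain ⟨hx3, hy2⟩ := euler (by exact_mod_cast hx) (by exact_mod_cast hy.ne') hZ
  refine ⟨?_, by exact_mod_cast hy2⟩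
  rcases hx3 with h3 | h3
  · exact_mod_cast h3
  · exfalso
    have : (0 : ℤ) ≤ (x : ℤ) := by positivity
    linarith

/-- **Catalan's conjecture from its odd prime case** [Schoof2009, Chapter 1, proof of the Main
theorem, p. 5]: with Lebesgue's (`Catalan.lebesgue`), Ko Chao's (`Catalan.koChao`) and Euler's
(`Catalan.euler`) cases proved, `mihailescu` follows from the single hypothesis that
`x ^ p ≠ y ^ q + 1` for odd primes `p, q` and natural numbers `x, y` with `y > 0` (Mihăilescu
2002/2004). [cite: Schoof2009, Ch. 1, Main theorem (proof, p. 5)] -/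
theorem mihailescu_of_odd_primes
    (hodd : ∀ {x y p q : ℕ}, 0 < y → p.Prime → q.Prime → Odd p → Odd q → x ^ p ≠ y ^ q + 1) :
    mihailescu :=
  mihailescu_of_cubic_of_odd_primes sq_eq_cube_add_one hodd

/-- **Catalan's conjecture from Mihăilescu's Theorems I, II, III** [Schoof2009, Chapter 1]:
`mihailescu` follows from the three theorems alone, each taken as an explicit hypothesis exactly
as stated on [Schoof2009, p. 4] for odd primes `p, q` and non-zero integers `x, y` with
`x ^ p - y ^ q = 1`: `hI` — Theorem I (P. Mihăilescu 2000; J. Number Theory **99** (2003);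
Stickelberger's theorem, [Schoof2009, Ch. 10]): `p ^ (q-1) ≡ 1 (mod q²)` and
`q ^ (p-1) ≡ 1 (mod p²)` (`IsWieferich p q ∧ IsWieferich q p`); `hII` — Theorem II (2002;
J. reine angew. Math. **572** (2004) [Mihailescu2004]; Thaine's theorem, [Schoof2009,
Ch. 12–14, 16]): `p ≡ 1 (mod q)` or `q ≡ 1 (mod p)`; `hIII` — Theorem III (2003; J. Number
Theory **118** (2006); [Schoof2009, Ch. 11]): `p < 4 q²` and `q < 4 p²`. Everything else —
Exercise 1.1, Lebesgue, Ko Chao, Euler, Exercises 1.2–1.3 and the final bookkeeping — is proved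
in the tree. [cite: Schoof2009, Ch. 1, Main theorem (proof, p. 5)] -/
theorem mihailescu_of_mihailescu_theorems
    (hI : ∀ {p q : ℕ} {x y : ℤ}, p.Prime → q.Prime → Odd p → Odd q → x ≠ 0 → y ≠ 0 →
      x ^ p - y ^ q = 1 → IsWieferich p q ∧ IsWieferich q p)
    (hII : ∀ {p q : ℕ} {x y : ℤ}, p.Prime → q.Prime → Odd p → Odd q → x ≠ 0 → y ≠ 0 →
      x ^ p - y ^ q = 1 → p ≡ 1 [MOD q] ∨ q ≡ 1 [MOD p])
    (hIII : ∀ {p q : ℕ} {x y : ℤ}, p.Prime → q.Prime → Odd p → Odd q → x ≠ 0 → y ≠ 0 →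
      x ^ p - y ^ q = 1 → p < 4 * q ^ 2 ∧ q < 4 * p ^ 2) :
    mihailescu :=
  mihailescu_of_euler_of_mihailescu_theorems sq_eq_cube_add_one hI hII hIII

end Catalan

end Literature.NumberTheory.DiophantineGeometry
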